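import Summits.Ventures.DiscreteObjects.Hadamard.InvolutionTypeII
import Summits.Ventures.DiscreteObjects.Hadamard.SignedAutCommute

/-!
# Hadamard 668 census, family F12 — Klein four-groups of signed automorphisms of an H(668): the dichotomy
# 'commuting lifts' / 'three fixed-point-free nega involutions' (kernel, structure only)

Framing: lottery ticket; floor = certified bounds/negative ranges.

Cell pub-namedobj (venture DiscreteObjects), target (H), hadamard gen 17 (lead g13 item H13-4; HANDOFF-H-g16 item 4 on
paper).  Two involutive signed-permutation automorphisms `S = (σ, σ', d, e)`, `T = (τ, τ', d', e')` of a Hadamard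
matrix (`σ² = σ'² = τ² = τ'² = 1`) with commuting permutation parts have signed lifts that commute up to one global sign
`ε = ±1` (`signedAut_comm_sign`, gen 16).  For an H(668) the final involution census (`hadamard668_involution_census_final`,
gen 13: type I — `f ≡ 4 (mod 8)` fixed rows and columns, ONE common sign on all of them — or fixed-point-free NEGA)
turns this into a DICHOTOMY, **`hadamard668_klein_four_dichotomy`**: if `σ, τ ≠ 1` (for `σ ≠ τ` the group
`⟨σ, τ⟩` is a Klein four-group on the rows; `σ = τ` is allowed and then `ε = +1`) then
* `ε = +1` as soon as `σ` and `τ` share a fixed row or a fixed column [at a common fixed point the commutation identity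
  reads `d d' = ε d' d`]; and
* if `ε = −1` then `σ`, `τ` AND `στ` are fixed-point-free on rows and on columns, and `S`, `T` are nega
  (`d (σ i) = −d i`, `d' (τ i) = −d' i`, and the same for columns) [a `σ`-fixed row `x` gives the `σ`-fixed row `τ x`
  with `d (τ x) = −d x`, against the one-sign property of type I; then `στ x = x` would give `τ x = σ x =: y` and
  `d y d' x = −d' y d x` with `d y = −d x`, `d' y = −d' x`, i.e. `2 d x d' x = 0`] — the quaternion / Williamson-type
  configuration (`P_S² = P_T² = −I`, `P_S P_T = −P_T P_S`).
No Klein four-group is excluded; this is the structure statement asked for.  Ours, not literature; no `sorry`.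
-/

namespace Summit.Ventures.DiscreteObjects.Hadamard

open Finset BigOperators Matrix

open Literature.Combinatorics.Designs.GoethalsSeidel (IsHadamardMatrix)

variable {ι : Type*} [Fintype ι] [DecidableEq ι]

variable {H : Matrix ι ι ℤ} {σ σ' τ τ' : Equiv.Perm ι} {d e d' e' : ι → ℤ}

/-- sign bookkeeping: from `a * b = ε * (c * a)` with `a = ±1` conclude `b = ε * c` -/
lemma pm_cancel_left {a b c ε : ℤ} (ha : a = 1 ∨ a = -1) (h : a * b = ε * (c * a)) : b = ε * c := by
  rcases ha with rfl | rfl <;> linarith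

/-- **Klein four-groups of signed automorphisms of an H(668): the dichotomy.** -/
theorem hadamard668_klein_four_dichotomy (hH : IsHadamardMatrix H) (hι : Fintype.card ι = 668)
    (hS : IsSignedAut H σ σ' d e) (hT : IsSignedAut H τ τ' d' e')
    (hσ : σ ^ 2 = 1) (hσ' : σ' ^ 2 = 1) (hτ : τ ^ 2 = 1) (hτ' : τ' ^ 2 = 1)
    (hc : Commute σ τ) (hc' : Commute σ' τ') (hσ1 : σ ≠ 1) (hτ1 : τ ≠ 1) :
    ∃ ε : ℤ, (ε = 1 ∨ ε = -1) ∧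
      (∀ x, d (τ x) * d' x = ε * (d' (σ x) * d x)) ∧ (∀ y, e (τ' y) * e' y = ε * (e' (σ' y) * e y)) ∧
      ((∃ x, σ x = x ∧ τ x = x) → ε = 1) ∧ ((∃ y, σ' y = y ∧ τ' y = y) → ε = 1) ∧
      (ε = -1 →
        (∀ i, σ i ≠ i) ∧ (∀ i, τ i ≠ i) ∧ (∀ i, (σ * τ) i ≠ i) ∧
        (∀ j, σ' j ≠ j) ∧ (∀ j, τ' j ≠ j) ∧ (∀ j, (σ' * τ') j ≠ j) ∧
        (∀ i, d (σ i) = -d i) ∧ (∀ i, d' (τ i) = -d' i) ∧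
        (∀ j, e (σ' j) = -e j) ∧ (∀ j, e' (τ' j) = -e' j)) := by
  have hcard : (Fintype.card ι : ℤ) ≠ 0 := by rw [hι]; norm_num
  have hH0 : ∀ i j, H i j ≠ 0 := fun i j => pm_ne_zero (hH.1 i j)
  haveI : Nonempty ι := Fintype.card_pos_iff.mp (by rw [hι]; norm_num)
  obtain ⟨ε, hε, hrow, hcol⟩ := signedAut_comm_sign hH0 hS hT hc hc'
  have hσinv : ∀ i, σ (σ i) = i := fun i => by
    have := congrArg (fun π : Equiv.Perm ι => π i) hσ; simpa [pow_two] using this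
  -- commuting: σ (τ i) = τ (σ i), σ' (τ' j) = τ' (σ' j)
  have hcomm : ∀ i, σ (τ i) = τ (σ i) := fun i => by
    have := congrArg (fun π : Equiv.Perm ι => π i) hc.eq; simpa [Equiv.Perm.mul_apply] using this
  have hcomm' : ∀ j, σ' (τ' j) = τ' (σ' j) := fun j => by
    have := congrArg (fun π : Equiv.Perm ι => π j) hc'.eq; simpa [Equiv.Perm.mul_apply] using this
  -- the two censuses
  have cS := hadamard668_involution_census_final hH hι σ σ' d e hS hσ hσ' (Or.inl hσ1)
  have cT := hadamard668_involution_census_final hH hι τ τ' d' e' hT hτ hτ' (Or.inl hτ1)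
  refine ⟨ε, hε, hrow, hcol, ?_, ?_, ?_⟩
  · rintro ⟨x, hσx, hτx⟩
    have h := hrow x
    rw [hτx, hσx] at h
    have h2 := pm_cancel_left (hS.1 x) h
    rcases hT.1 x with h3 | h3 <;> rw [h3] at h2 <;> linarith
  · rintro ⟨y, hσy, hτy⟩
    have h := hcol y
    rw [hτy, hσy] at h
    have h2 := pm_cancel_left (hS.2.1 y) h
    rcases hT.2.1 y with h3 | h3 <;> rw [h3] at h2 <;> linarith
  · intro hε1
    subst hε1
    -- (a) σ has no fixed row: a fixed row i gives the fixed row τ i with d (τ i) = - d i, against one sign δ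
    have hσf : ∀ i, σ i ≠ i := by
      intro i hi
      obtain ⟨-, -, hI | ⟨h0, -⟩⟩ := cS
      · obtain ⟨-, -, -, -, δ, hδpm, hδ, -⟩ := hI
        have h := hrow i
        rw [hi] at h
        have h1 : d (τ i) = -d i := by rcases hT.1 i with h3 | h3 <;> rw [h3] at h <;> linarith
        have hτi : σ (τ i) = τ i := by rw [hcomm, hi]
        rw [hδ i hi, hδ (τ i) hτi] at h1
        rcases hδpm with h4 | h4 <;> rw [h4] at h1 <;> norm_num at h1
      · have hmem : i ∈ univ.filter (fun i => σ i = i) := by simp [hi]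
        rw [Finset.card_eq_zero.mp h0] at hmem
        simp at hmem
    -- (b) τ has no fixed row
    have hτf : ∀ i, τ i ≠ i := by
      intro i hi
      obtain ⟨-, -, hI | ⟨h0, -⟩⟩ := cT
      · obtain ⟨-, -, -, -, δ, hδpm, hδ, -⟩ := hI
        have h := hrow i
        rw [hi] at h
        have h1 : d' (σ i) = -d' i := by rcases hS.1 i with h3 | h3 <;> rw [h3] at h <;> linarith
        have hσi : τ (σ i) = σ i := by rw [← hcomm, hi]
        rw [hδ i hi, hδ (σ i) hσi] at h1
        rcases hδpm with h4 | h4 <;> rw [h4] at h1 <;> norm_num at h1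
      · have hmem : i ∈ univ.filter (fun i => τ i = i) := by simp [hi]
        rw [Finset.card_eq_zero.mp h0] at hmem
        simp at hmem
    -- (c) hence both are of nega type (census: type I needs ≥ 4 fixed rows)
    have hSn : (univ.filter fun j => σ' j = j).card = 0 ∧ (∀ i, d (σ i) = -d i) ∧ (∀ j, e (σ' j) = -e j) := by
      obtain ⟨-, -, hI | ⟨-, h0c, hd0, he0⟩⟩ := cS
      · obtain ⟨-, -, h4, -, -⟩ := hI
        have hz : (univ.filter fun i => σ i = i).card = 0 := by
          rw [Finset.card_eq_zero, Finset.filter_eq_empty_iff]; intro i _; exact hσf i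
        omega
      · exact ⟨h0c, hd0, he0⟩
    have hTn : (univ.filter fun j => τ' j = j).card = 0 ∧ (∀ i, d' (τ i) = -d' i) ∧ (∀ j, e' (τ' j) = -e' j) := by
      obtain ⟨-, -, hI | ⟨-, h0c, hd0, he0⟩⟩ := cT
      · obtain ⟨-, -, h4, -, -⟩ := hI
        have hz : (univ.filter fun i => τ i = i).card = 0 := by
          rw [Finset.card_eq_zero, Finset.filter_eq_empty_iff]; intro i _; exact hτf i
        omega
      · exact ⟨h0c, hd0, he0⟩
    obtain ⟨hσ'0, hdn, hen⟩ := hSn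
    obtain ⟨hτ'0, hdn', hen'⟩ := hTn
    have hσ'f : ∀ j, σ' j ≠ j := by
      intro j hj
      have hmem : j ∈ univ.filter (fun j => σ' j = j) := by simp [hj]
      rw [Finset.card_eq_zero.mp hσ'0] at hmem
      simp at hmem
    have hτ'f : ∀ j, τ' j ≠ j := by
      intro j hj
      have hmem : j ∈ univ.filter (fun j => τ' j = j) := by simp [hj]
      rw [Finset.card_eq_zero.mp hτ'0] at hmem
      simp at hmem
    -- (d) στ has no fixed row / column
    have hστf : ∀ i, (σ * τ) i ≠ i := by
      intro i hi
      rw [Equiv.Perm.mul_apply] at hi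
      -- τ i = σ i
      have hy : τ i = σ i := by
        have := congrArg σ hi
        rw [hσinv] at this
        exact this
      have h := hrow i
      rw [hy, hdn i] at h
      have h5 := hdn' i
      rw [hy] at h5
      rw [h5] at h
      -- h : -d i * d' i = -1 * (-d' i * d i)
      have hdd : d i * d i = 1 := pm_mul_self (hS.1 i)
      have hdd' : d' i * d' i = 1 := pm_mul_self (hT.1 i)
      nlinarith [hdd, hdd']
    have hσ'inv : ∀ j, σ' (σ' j) = j := fun j => by
      have := congrArg (fun π : Equiv.Perm ι => π j) hσ'; simpa [pow_two] using this
    have hστ'f : ∀ j, (σ' * τ') j ≠ j := by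
      intro j hj
      rw [Equiv.Perm.mul_apply] at hj
      have hy : τ' j = σ' j := by
        have := congrArg σ' hj
        rw [hσ'inv] at this
        exact this
      have h := hcol j
      rw [hy, hen j] at h
      have h5 := hen' j
      rw [hy] at h5
      rw [h5] at h
      have hee : e j * e j = 1 := pm_mul_self (hS.2.1 j)
      have hee' : e' j * e' j = 1 := pm_mul_self (hT.2.1 j)
      nlinarith [hee, hee']
    exact ⟨hσf, hτf, hστf, hσ'f, hτ'f, hστ'f, hdn, hdn', hen, hen'⟩

end Summit.Ventures.DiscreteObjects.Hadamard
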